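import Summits.ValiantsHypothesis.ValiantsHypothesis.Theses.GirthSidon

/-!
# `GirthSidon.LowMonomialCurvesSwallowed` (stmt-ValiantsHypothesis-6541) — low monomial curves are swallowed

`LowMonomialCurvesSwallowed_proof : Theses.GirthSidon.LowMonomialCurvesSwallowed`: if
`m * ((m - 1) * D + 1) < 2 ^ (m - 1)` then every monomial curve `x ↦ (x ^ {d i})_{i < m}` with exponents
`1 ≤ d i ≤ D` is NOT `(m - 1, 2)`-elusive over `ℂ` (Raz 2010, Def. 1.1; tree `IsElusive`).

Proof (negative knowledge at `s = m - 1`, generalising `Elusive.not_elusive_candidate`):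
* `m = 0` is trivial; write `m = n + 1`.
* Pigeonhole (`Finset.exists_ne_map_eq_of_card_lt_of_maps_to`): the `2 ^ n` subsets `S` of the first `n`
  coordinates map to the `(n + 1) * (n * D + 1)` pairs `(#S, Σ_{i ∈ S} d i)`, so two subsets `S ≠ T`
  share cardinality and `d`-sum; `S \ T` and `T \ S` are disjoint, nonempty, of equal size `k + 1`, with
  equal `d`-sums. Enumerate them as `σ, τ : Fin (k + 1) → Fin (n + 1)`.
* Path gadget with half-edge ends (`not_isElusive_of_alternating_relation`): coordinates
  `Γ (σ 0) = y_{τ 0}`, `Γ (σ j) = y_{σ j} y_{τ j}` (`j ≥ 1`), `Γ (τ j) = y_{τ j} y_{σ (j+1)}` (`j < k`),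
  `Γ (τ k) = y_{τ k}`, and `Γ i = y_i` for every other coordinate. The variable `y_{σ 0}` is never
  used, so `Γ` is a quadratic map in the `n` variables `{v // v ≠ σ 0} ≃ Fin n`. Along the curve, for
  `x ≠ 0` put `y_{τ j} = x ^ {f j}`, `y_{σ j} = x ^ {g j}` with the integer prefix sums
  `f j = Σ_{l ≤ j} d (σ l) - Σ_{l < j} d (τ l)`, `g j = Σ_{l < j} d (τ l) - Σ_{l < j} d (σ l)` and
  `y_i = x ^ {d i}` otherwise; the last coordinate matches exactly because of the relation
  `Σ_j d (σ j) = Σ_j d (τ j)`. At `x = 0` take `y = 0` (all `d i ≥ 1`).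
-/

namespace Summit.ValiantsHypothesis.ValiantsHypothesis.Theorems

-- `Summit.ValiantsHypothesis.ValiantsHypothesis.…` is the tree's mandated single-conjunct layout (Sub = Summit).
set_option linter.dupNamespace false

open MvPolynomial Literature.Computability.AlgebraicComplexity

/-- Transfer: a tuple `Γ` of degree-`≤ r` polynomials in ANY variable type `V` equivalent to `Fin s` whose
image contains the image of `f` witnesses that `f` is not `(s, r)`-elusive (rename the variables along
the equivalence). [folklore] -/
theorem not_isElusive_of_range_subset_equiv {R : Type*} [CommSemiring R] {ι α V : Type*} {s r : ℕ}
    (f : ι → MvPolynomial α R) (e : V ≃ Fin s) (Γ : ι → MvPolynomial V R)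
    (hdeg : ∀ i, (Γ i).totalDegree ≤ r)
    (hsub : Set.range (polyMapEval f) ⊆ Set.range (polyMapEval Γ)) : ¬ IsElusive f s r := by
  intro h
  refine h (fun i => rename e (Γ i)) (fun i => (totalDegree_rename_le _ _).trans (hdeg i)) ?_
  intro v hv
  obtain ⟨y, rfl⟩ := hsub hv
  refine ⟨y ∘ e.symm, ?_⟩
  rw [polyMapEval_rename]
  congr 1
  funext w
  simp

/-- **Path gadget.** If the exponents of a monomial curve `x ↦ (x ^ {d i})_{i : Fin (n+1)}` (all
`d i ≥ 1`) satisfy an alternating relation `Σ_j d (σ j) = Σ_j d (τ j)` along two disjoint injective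
enumerations `σ, τ : Fin (k + 1) → Fin (n + 1)`, then the curve lies in the image of a quadratic
MONOMIAL map in `n` variables, so it is not `(n, 2)`-elusive. [folklore] -/
theorem not_isElusive_of_alternating_relation {n k : ℕ} (d : Fin (n + 1) → ℕ) (hd : ∀ i, 1 ≤ d i)
    (σ τ : Fin (k + 1) → Fin (n + 1)) (hσ : Function.Injective σ) (hτ : Function.Injective τ)
    (hστ : ∀ j l, σ j ≠ τ l) (hrel : ∑ j, d (σ j) = ∑ j, d (τ j)) :
    ¬ IsElusive (fun i : Fin (n + 1) => (X 0 : MvPolynomial (Fin 1) ℂ) ^ d i) n 2 := by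
  classical
  -- the omitted variable `o = σ 0`; variables `V = {v // v ≠ o}`
  set o : Fin (n + 1) := σ 0 with ho
  have hτo : ∀ l, τ l ≠ o := fun l h => hστ 0 l h.symm
  have hσo : ∀ j : Fin (k + 1), j ≠ 0 → σ j ≠ o := fun j hj h => hj (hσ h)
  let V := {v : Fin (n + 1) // v ≠ o}
  let κ : Fin (n + 1) → V := fun a => if h : a = o then ⟨τ 0, hτo 0⟩ else ⟨a, h⟩
  have hκ : ∀ a, a ≠ o → ((κ a : V) : Fin (n + 1)) = a := fun a ha => by
    simp only [κ, dif_neg ha]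
  -- the gadget
  let P : Fin (k + 1) → MvPolynomial V ℂ := fun j =>
    if j = 0 then X (κ (τ 0)) else X (κ (σ j)) * X (κ (τ j))
  let Q : Fin (k + 1) → MvPolynomial V ℂ := fun j =>
    if h : j = Fin.last k then X (κ (τ j)) else X (κ (τ j)) * X (κ (σ (j.castPred h).succ))
  let Γ : Fin (n + 1) → MvPolynomial V ℂ :=
    Function.extend σ P (Function.extend τ Q fun i => X (κ i))
  have hΓσ : ∀ j, Γ (σ j) = P j := fun j => hσ.extend_apply _ _ j
  have hΓτ : ∀ j, Γ (τ j) = Q j := fun j => by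
    show Function.extend σ P _ (τ j) = Q j
    rw [Function.extend_apply' _ _ _ fun ⟨l, hl⟩ => hστ l j hl]
    exact hτ.extend_apply _ _ j
  have hΓr : ∀ i, (¬ ∃ j, σ j = i) → (¬ ∃ j, τ j = i) → Γ i = X (κ i) := fun i h1 h2 => by
    show Function.extend σ P _ i = _
    rw [Function.extend_apply' _ _ _ h1, Function.extend_apply' _ _ _ h2]
  have tri : ∀ i, (∃ j, σ j = i) ∨ (∃ j, τ j = i) ∨ ((¬ ∃ j, σ j = i) ∧ ¬ ∃ j, τ j = i) :=
    fun i => by tauto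
  -- degrees
  have hX : ∀ v : V, (X v : MvPolynomial V ℂ).totalDegree ≤ 2 := fun v => by
    rw [totalDegree_X]; norm_num
  have hXX : ∀ v w : V, (X v * X w : MvPolynomial V ℂ).totalDegree ≤ 2 := fun v w =>
    (totalDegree_mul _ _).trans (by rw [totalDegree_X, totalDegree_X])
  have hdeg : ∀ i, (Γ i).totalDegree ≤ 2 := by
    intro i
    rcases tri i with ⟨j, rfl⟩ | ⟨j, rfl⟩ | ⟨h1, h2⟩
    · rw [hΓσ]; simp only [P]; split_ifs; exacts [hX _, hXX _ _]
    · rw [hΓτ]; simp only [Q]; split_ifs; exacts [hX _, hXX _ _]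
    · rw [hΓr i h1 h2]; exact hX _
  -- integer exponents (prefix sums)
  let dσ : ℕ → ℤ := fun l => if h : l < k + 1 then (d (σ ⟨l, h⟩) : ℤ) else 0
  let dτ : ℕ → ℤ := fun l => if h : l < k + 1 then (d (τ ⟨l, h⟩) : ℤ) else 0
  let f : ℕ → ℤ := fun j => ∑ l ∈ Finset.range (j + 1), dσ l - ∑ l ∈ Finset.range j, dτ l
  let g : ℕ → ℤ := fun j => ∑ l ∈ Finset.range j, dτ l - ∑ l ∈ Finset.range j, dσ l
  have hdσ : ∀ j : Fin (k + 1), dσ j = d (σ j) := fun j => by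
    simp only [dσ, dif_pos j.isLt, Fin.eta]
  have hdτ : ∀ j : Fin (k + 1), dτ j = d (τ j) := fun j => by
    simp only [dτ, dif_pos j.isLt, Fin.eta]
  have hrel' : ∑ l ∈ Finset.range (k + 1), dσ l = ∑ l ∈ Finset.range (k + 1), dτ l := by
    rw [← Fin.sum_univ_eq_sum_range, ← Fin.sum_univ_eq_sum_range]
    simp only [hdσ, hdτ]
    exact_mod_cast hrel
  have I0 : f 0 = d (σ 0) := by
    have := hdσ 0
    simp only [Fin.val_zero] at this
    simp only [f, Finset.sum_range_succ, Finset.sum_range_zero, zero_add, sub_zero, this]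
  have I1 : ∀ j : Fin (k + 1), g j + f j = d (σ j) := fun j => by
    rw [← hdσ]; simp only [f, g, Finset.sum_range_succ]; ring
  have I2 : ∀ j : Fin (k + 1), f j + g (j + 1) = d (τ j) := fun j => by
    rw [← hdτ]; simp only [f, g, Finset.sum_range_succ]; ring
  have I3 : f (Fin.last k : Fin (k + 1)) = d (τ (Fin.last k)) := by
    rw [← hdτ, Fin.val_last]; simp only [f]; rw [hrel', Finset.sum_range_succ]; ring
  -- values along the curve
  let Y : ℂ → Fin (n + 1) → ℂ := fun x => if x = 0 then 0 else
    Function.extend σ (fun j => x ^ g j) (Function.extend τ (fun j => x ^ f j) fun i => x ^ (d i : ℤ))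
  have hY0 : ∀ i, Y 0 i = 0 := fun i => by simp [Y]
  have hYσ : ∀ x, x ≠ 0 → ∀ j, Y x (σ j) = x ^ g j := fun x hx j => by
    simp only [Y, if_neg hx]
    exact hσ.extend_apply _ _ j
  have hYτ : ∀ x, x ≠ 0 → ∀ j, Y x (τ j) = x ^ f j := fun x hx j => by
    simp only [Y, if_neg hx]
    rw [Function.extend_apply' _ _ _ fun ⟨l, hl⟩ => hστ l j hl]
    exact hτ.extend_apply _ _ j
  have hYr : ∀ x, x ≠ 0 → ∀ i, (¬ ∃ j, σ j = i) → (¬ ∃ j, τ j = i) → Y x i = x ^ (d i : ℤ) :=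
    fun x hx i h1 h2 => by
    simp only [Y, if_neg hx]
    rw [Function.extend_apply' _ _ _ h1, Function.extend_apply' _ _ _ h2]
  have key : ∀ x : ℂ, x ≠ 0 → ∀ (a b : ℤ) (N : ℕ), a + b = N → x ^ a * x ^ b = x ^ N :=
    fun x hx a b N h => by rw [← zpow_add₀ hx, h, zpow_natCast]
  have key1 : ∀ x : ℂ, ∀ (a : ℤ) (N : ℕ), a = N → x ^ a = x ^ N :=
    fun x a N h => by rw [h, zpow_natCast]
  let y : ℂ → V → ℂ := fun x v => Y x v.1
  have hev : ∀ x a, a ≠ o → eval (y x) (X (κ a)) = Y x a := fun x a ha => by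
    rw [eval_X]; show Y x (κ a).1 = Y x a; rw [hκ a ha]
  have hd0 : ∀ i, (0 : ℂ) ^ d i = 0 := fun i => zero_pow (by have := hd i; omega)
  have claim : ∀ i x, eval (y x) (Γ i) = x ^ d i := by
    intro i x
    rcases tri i with ⟨j, rfl⟩ | ⟨j, rfl⟩ | ⟨h1, h2⟩
    · rw [hΓσ]; simp only [P]
      split_ifs with hj
      · subst hj
        rw [hev x _ (hτo 0)]
        by_cases hx : x = 0
        · subst hx; rw [hY0, hd0]
        · rw [hYτ x hx]; exact key1 x _ _ I0
      · rw [map_mul, hev x _ (hσo j hj), hev x _ (hτo j)]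
        by_cases hx : x = 0
        · subst hx; rw [hY0, hd0, zero_mul]
        · rw [hYσ x hx, hYτ x hx]; exact key x hx _ _ _ (I1 j)
    · rw [hΓτ]; simp only [Q]
      split_ifs with hj
      · subst hj
        rw [hev x _ (hτo _)]
        by_cases hx : x = 0
        · subst hx; rw [hY0, hd0]
        · rw [hYτ x hx]; exact key1 x _ _ I3
      · rw [map_mul, hev x _ (hτo j), hev x _ (hσo _ (Fin.succ_ne_zero _))]
        by_cases hx : x = 0
        · subst hx; rw [hY0, hd0, zero_mul]
        · rw [hYτ x hx, hYσ x hx]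
          refine key x hx _ _ _ ?_
          have hj1 : (((j.castPred hj).succ : Fin (k + 1)) : ℕ) = j + 1 := by simp
          rw [hj1]; exact I2 j
    · have hio : i ≠ o := fun h => h1 ⟨0, h.symm⟩
      rw [hΓr i h1 h2, hev x _ hio]
      by_cases hx : x = 0
      · subst hx; rw [hY0, hd0]
      · rw [hYr x hx i h1 h2, zpow_natCast]
  -- conclude
  refine not_isElusive_of_range_subset_equiv _ (finSuccAboveEquiv o).symm Γ hdeg ?_
  rintro _ ⟨xv, rfl⟩
  refine ⟨y (xv 0), funext fun i => ?_⟩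
  rw [polyMapEval_apply, polyMapEval_apply, map_pow, eval_X]
  exact claim i (xv 0)

/-- **Low monomial curves are swallowed** — settles `stmt-ValiantsHypothesis-6541`
(`Theses.GirthSidon.LowMonomialCurvesSwallowed`): if `m * ((m - 1) * D + 1) < 2 ^ (m - 1)` then no
monomial curve `x ↦ (x ^ {d i})_{i < m}` with `1 ≤ d i ≤ D` is `(m - 1, 2)`-elusive over `ℂ`.
Pigeonhole on `(#S, Σ_S d)` over subsets of the first `m - 1` coordinates gives an alternating relation,
and `not_isElusive_of_alternating_relation` realises a monomial quadratic swallower in `m - 1` variables.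
[folklore] -/
theorem LowMonomialCurvesSwallowed_proof : Theses.GirthSidon.LowMonomialCurvesSwallowed := by
  unfold Theses.GirthSidon.LowMonomialCurvesSwallowed
  intro m D hm d hd
  classical
  rcases Nat.eq_zero_or_pos m with rfl | hmpos
  · -- `m = 0`: every point of `ℂ^0` is in the image of any map
    intro h
    refine h (fun i => i.elim0) (fun i => i.elim0) ?_
    rintro v -
    exact ⟨fun _ => 0, funext fun i => i.elim0⟩
  obtain ⟨n, rfl⟩ : ∃ n, m = n + 1 := ⟨m - 1, by omega⟩
  simp only [Nat.add_sub_cancel] at hm ⊢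
  have hcardE : (Finset.univ.erase (Fin.last n)).card = n := by
    rw [Finset.card_erase_of_mem (Finset.mem_univ _), Finset.card_univ, Fintype.card_fin]
    rfl
  -- pigeonhole on `S ↦ (#S, Σ_S d)` over subsets of the first `n` coordinates
  obtain ⟨S, -, T, -, hne, hST⟩ := Finset.exists_ne_map_eq_of_card_lt_of_maps_to
    (s := (Finset.univ.erase (Fin.last n)).powerset)
    (t := Finset.range (n + 1) ×ˢ Finset.range (n * D + 1))
    (f := fun S => (S.card, ∑ i ∈ S, d i)) (by
      rw [Finset.card_product, Finset.card_range, Finset.card_range, Finset.card_powerset, hcardE]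
      exact hm) (by
      intro S hS
      have hS' : S ⊆ Finset.univ.erase (Fin.last n) := Finset.mem_powerset.1 (Finset.mem_coe.1 hS)
      have hc : S.card ≤ n := by have := Finset.card_le_card hS'; rwa [hcardE] at this
      have h1 : ∑ i ∈ S, d i ≤ ∑ _i ∈ S, D := Finset.sum_le_sum fun i _ => (hd i).2
      rw [Finset.sum_const, smul_eq_mul] at h1
      have h2 : S.card * D ≤ n * D := Nat.mul_le_mul_right _ hc
      refine Finset.mem_coe.2 (Finset.mem_product.2 ⟨Finset.mem_range.2 ?_, Finset.mem_range.2 ?_⟩)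
      · show S.card < n + 1
        omega
      · show ∑ i ∈ S, d i < n * D + 1
        omega)
  simp only [Prod.mk.injEq] at hST
  obtain ⟨hcard, hsum⟩ := hST
  -- disjointify: `S \ T` and `T \ S`
  have hcard' : (S \ T).card = (T \ S).card := by
    have h1 := Finset.card_sdiff_add_card_inter S T
    have h2 := Finset.card_sdiff_add_card_inter T S
    rw [Finset.inter_comm T S] at h2
    omega
  have hsum' : ∑ i ∈ S \ T, d i = ∑ i ∈ T \ S, d i := by
    have h1 := Finset.sum_inter_add_sum_sdiff S T d
    have h2 := Finset.sum_inter_add_sum_sdiff T S d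
    rw [Finset.inter_comm T S] at h2
    omega
  have hne' : (S \ T).Nonempty := by
    rw [Finset.nonempty_iff_ne_empty]
    intro h
    rw [Finset.sdiff_eq_empty_iff_subset] at h
    exact hne (Finset.eq_of_subset_of_card_le h hcard.ge)
  obtain ⟨k, hk⟩ : ∃ k, (S \ T).card = k + 1 := ⟨(S \ T).card - 1, by have := hne'.card_pos; omega⟩
  have hkT : (T \ S).card = k + 1 := by omega
  -- enumerate and apply the path gadget
  refine not_isElusive_of_alternating_relation d (fun i => (hd i).1) ((S \ T).orderEmbOfFin hk)
    ((T \ S).orderEmbOfFin hkT) ((S \ T).orderEmbOfFin hk).injective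
    ((T \ S).orderEmbOfFin hkT).injective ?_ ?_
  · intro j l h
    have h1 := (S \ T).orderEmbOfFin_mem hk j
    have h2 := Finset.mem_sdiff.1 ((T \ S).orderEmbOfFin_mem hkT l)
    rw [h] at h1
    exact (Finset.mem_sdiff.1 h1).2 h2.1
  · have e1 : ∑ j, d ((S \ T).orderEmbOfFin hk j) = ∑ i ∈ S \ T, d i := by
      rw [← Finset.sum_image (f := d) fun x _ y _ h => ((S \ T).orderEmbOfFin hk).injective h,
        Finset.image_orderEmbOfFin_univ]
    have e2 : ∑ j, d ((T \ S).orderEmbOfFin hkT j) = ∑ i ∈ T \ S, d i := by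
      rw [← Finset.sum_image (f := d) fun x _ y _ h => ((T \ S).orderEmbOfFin hkT).injective h,
        Finset.image_orderEmbOfFin_univ]
    rw [e1, e2, hsum']

end Summit.ValiantsHypothesis.ValiantsHypothesis.Theorems
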